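import Literature.Probability.RandomPlanarGeometry.SAWCountMonotoneNearPolygon
import Literature.Probability.RandomPlanarGeometry.SAWCountMonotoneUpToFourD
import HarnessLib

/-!
# Monotonicity `cₙ ≤ cₙ₊₁` (O'Brien 1990): the NEAR-POLYGON RULE — `cₙ ≤ cₙ₊₁ + #(R \ S)` with `S` the
# residual near-polygons whose cycle has a unique doubly-caged edge

Sequel of `SAWCountMonotoneNearPolygon.lean` (rotation `cycRot`, selector `prefSel`, spare extension,
`nearPolygon_spare`, `cycRot_cycRot`) and `SAWCountMonotoneEscapeSpare.lean` (the socket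
`count_le_count_succ_add_card_sdiff_of_spare`).  A residual walk `ω ∈ R(d, n)` (doomed end, surrounded start)
whose end is TRAPPED and adjacent to the start is a **near-polygon**: its sites carry the lattice cycle
`ω 0, …, ω n, ω 0`, on which the closing edge `{ω n, ω 0}` is *doubly caged* (both endpoints have all `2d`
lattice neighbours on the walk).  Let `S = npClass d n a b` be the residual near-polygons with NO OTHER
doubly-caged cycle edge.  The rule: rotate at the index `J` of the site maximising the coordinate `a`
(ties broken by the coordinate `b ≠ a`), and append `+e_b`.  By `nearPolygon_spare` the image is a spare
free-ended `(n+1)`-step walk for the selector `prefSel n a`; it is INJECTIVE on `S` because the image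
remembers the cycle with its orientation, the unique doubly-caged edge marks where `ω` was cut open, and
rotating back (`cycRot_cycRot`) recovers `ω`.  Hence

* `count_le_count_succ_add_card_sdiff_npClass` : **`cₙ ≤ cₙ₊₁ + #(R(d,n) \ npClass d n a b)`** (`a ≠ b`).

Exhaustive enumeration (lane «pcv-sawmu» a-p4 g27, kit j312058 / j312060; not used in proofs): at the first
odd length where the escape route fails, `n = 6d - 1`, ALL residual walks lie in `S` for `d = 2` (`8` walks)
and `d = 3` (`2736` walks), so there the right-hand side is `cₙ₊₁`; conjecturally (`NP-1`) this holds in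
every dimension, which would give O'Brien's inequality at `n = 6d - 1`.

[cite: MadrasSlade1993, §1.1; §7.1 p. 231 (`c_{N+1} ≥ c_N`, O'Brien)] [cite: BDGS2012, §1.3 (`cₙ ≤ cₙ₊₁`, O'Brien 1990)]
-/

noncomputable section

open Literature.Probability.LatticeModels Literature.Probability.Percolation SimpleGraph

namespace Literature.Probability.RandomPlanarGeometry.SAW.Zd

variable {d : ℕ}

/-! ### Caged sites -/

/-- `x` is **caged** by the walk `ω` up to time `n`: every lattice neighbour of `x` is a site `ω i`, `i ≤ n`.
[cite: MadrasSlade1993, §1.1] -/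
def Caged (ω : ℕ → Site d) (n : ℕ) (x : Site d) : Prop :=
  ∀ y, (zdGraph d).Adj x y → ∃ i ≤ n, ω i = y

/-- Cagedness only depends on the set of sites, and is translation-covariant: the sites of the rotated
walk are the translates by `-c`, `c = ω (cycIdx n j 0)`. [cite: MadrasSlade1993, §1.1] -/
theorem caged_cycRot_iff {ω : ℕ → Site d} {n j : ℕ} (hj : j ≤ n) (x : Site d) :
    Caged (cycRot n ω j) n (x - ω (cycIdx n j 0)) ↔ Caged ω n x := by
  set c := ω (cycIdx n j 0) with hc
  constructor
  · intro h y hy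
    have hy' : (zdGraph d).Adj (x - c) (y - c) := (zdGraph_adj_sub_right _ _ _).2 hy
    obtain ⟨t, ht, hty⟩ := h (y - c) hy'
    refine ⟨cycIdx n j t, cycIdx_le hj ht, ?_⟩
    rw [cycRot_apply_of_le ht] at hty
    exact sub_left_injective hty
  · intro h y hy
    have hy' : (zdGraph d).Adj x (y + c) := by
      have := (zdGraph_adj_add_right _ _ c).2 hy; rwa [sub_add_cancel] at this
    obtain ⟨i, hi, hiy⟩ := h (y + c) hy'
    obtain ⟨t, ht, hte⟩ := exists_cycRot_eq (ω := ω) hj hi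
    exact ⟨t, ht, by rw [hte, hiy, add_sub_cancel_right]⟩

/-- Cagedness of the sites of the rotated walk, by index. [cite: MadrasSlade1993, §1.1] -/
theorem caged_cycRot_apply_iff {ω : ℕ → Site d} {n j t : ℕ} (hj : j ≤ n) (ht : t ≤ n) :
    Caged (cycRot n ω j) n (cycRot n ω j t) ↔ Caged ω n (ω (cycIdx n j t)) := by
  rw [cycRot_apply_of_le ht]; exact caged_cycRot_iff hj _

/-- A trapped end is caged. [cite: MadrasSlade1993, §1.1] -/
theorem caged_end_of_extCount_eq_zero {ω : ℕ → Site d} {n : ℕ} (h : extCount ω n = 0) :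
    Caged ω n (ω n) := by
  intro y hy
  by_contra hne
  push Not at hne
  have : y ∈ freeNbrs ω n := mem_freeNbrs.2 ⟨hy, fun i hi hiy => hne i hi hiy⟩
  rw [extCount, Finset.card_eq_zero] at h
  rw [h] at this
  exact Finset.notMem_empty y this

/-- A surrounded start is caged. [cite: MadrasSlade1993, §1.1] -/
theorem caged_start_of_extCount_revWalk_eq_zero {ω : ℕ → Site d} {n : ℕ} (hω : ω ∈ saws d n)
    (h : extCount (revWalk n ω) n = 0) : Caged ω n (ω 0) := by
  intro y hy
  by_contra hne
  push Not at hne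
  have : 0 < ((nbrs (ω 0)).filter fun z => ∀ i ≤ n, ω i ≠ z).card :=
    Finset.card_pos.2 ⟨y, Finset.mem_filter.2 ⟨mem_nbrs.2 hy, hne⟩⟩
  have := card_filter_nbrs_start_le_extCount_revWalk hω
  omega

/-! ### The class `S`: residual near-polygons with a unique doubly-caged cycle edge -/

open Classical in
/-- **`npClass d n`**: the residual walks (`escapeResidual d n`) with trapped end adjacent to the start
(near-polygons; the closing cycle edge `{ω n, ω 0}` is then doubly caged) such that no other cycle edge
`{ω i, ω (i+1)}`, `i < n`, is doubly caged. [cite: BDGS2012, §1.3] -/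
def npClass (d n : ℕ) : Finset (ℕ → Site d) :=
  (escapeResidual d n).filter fun ω => extCount ω n = 0 ∧ (zdGraph d).Adj (ω n) (ω 0) ∧
    ∀ i < n, ¬ (Caged ω n (ω i) ∧ Caged ω n (ω (i + 1)))

open Classical in
/-- Membership in `npClass`. [cite: BDGS2012, §1.3] -/
theorem mem_npClass {n : ℕ} {ω : ℕ → Site d} : ω ∈ npClass d n ↔ ω ∈ escapeResidual d n ∧
    extCount ω n = 0 ∧ (zdGraph d).Adj (ω n) (ω 0) ∧
      ∀ i < n, ¬ (Caged ω n (ω i) ∧ Caged ω n (ω (i + 1))) := by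
  rw [npClass, Finset.mem_filter]

open Classical in
/-- `npClass ⊆ R`. [cite: BDGS2012, §1.3] -/
theorem npClass_subset (d n : ℕ) : npClass d n ⊆ escapeResidual d n := Finset.filter_subset _ _

/-! ### The cut index: the site maximising the coordinate `a`, ties broken by `b` -/

/-- A two-level argmax over the times `0, …, n`. [cite: MadrasSlade1993, §1.1] -/
theorem exists_argmax₂ (ω : ℕ → Site d) (n : ℕ) (a b : Fin d) : ∃ j ≤ n,
    (∀ i ≤ n, ω i a ≤ ω j a) ∧ (∀ i ≤ n, ω i a = ω j a → ω i b ≤ ω j b) := by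
  classical
  obtain ⟨j₀, hj₀, hmax₀⟩ := (Finset.range (n + 1)).exists_max_image (fun i => ω i a)
    ⟨0, Finset.mem_range.2 (Nat.succ_pos n)⟩
  set T := (Finset.range (n + 1)).filter fun i => ω i a = ω j₀ a with hT
  have hTne : T.Nonempty := ⟨j₀, Finset.mem_filter.2 ⟨hj₀, rfl⟩⟩
  obtain ⟨j, hj, hmax⟩ := T.exists_max_image (fun i => ω i b) hTne
  obtain ⟨hjr, hja⟩ := Finset.mem_filter.1 hj
  refine ⟨j, by have := Finset.mem_range.1 hjr; omega, fun i hi => ?_, fun i hi hia => ?_⟩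
  · rw [hja]; exact hmax₀ i (Finset.mem_range.2 (by omega))
  · exact hmax i (Finset.mem_filter.2 ⟨Finset.mem_range.2 (by omega), by rw [hia, hja]⟩)

/-- **The cut index** `npCutIdx n a b ω`: a time `j ≤ n` whose site maximises the coordinate `a`, and among
those the coordinate `b`. [cite: MadrasSlade1993, §1.1] -/
def npCutIdx (n : ℕ) (a b : Fin d) (ω : ℕ → Site d) : ℕ := Classical.choose (exists_argmax₂ ω n a b)

/-- Specification of the cut index. [cite: MadrasSlade1993, §1.1] -/
theorem npCutIdx_spec (n : ℕ) (a b : Fin d) (ω : ℕ → Site d) :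
    npCutIdx n a b ω ≤ n ∧ (∀ i ≤ n, ω i a ≤ ω (npCutIdx n a b ω) a) ∧
      (∀ i ≤ n, ω i a = ω (npCutIdx n a b ω) a → ω i b ≤ ω (npCutIdx n a b ω) b) :=
  Classical.choose_spec (exists_argmax₂ ω n a b)

/-- The `+e_b` neighbour of the cut site is unvisited (`a ≠ b`). [cite: MadrasSlade1993, §1.1] -/
theorem ne_cut_add_single {n : ℕ} {a b : Fin d} (hab : a ≠ b) (ω : ℕ → Site d) :
    ∀ i ≤ n, ω i ≠ ω (npCutIdx n a b ω) + Pi.single b 1 := by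
  obtain ⟨-, hmax, htie⟩ := npCutIdx_spec n a b ω
  intro i hi h
  have ha : ω i a = ω (npCutIdx n a b ω) a := by
    have := congrFun h a
    rw [Pi.add_apply, Pi.single_eq_of_ne hab, add_zero] at this
    exact this
  have hb := htie i hi ha
  have := congrFun h b
  rw [Pi.add_apply, Pi.single_eq_same] at this
  omega

/-! ### The rule and its injectivity -/

/-- **The near-polygon rule**: rotate at the cut index and append `+e_b`. [cite: BDGS2012, §1.3] -/
def npMap (n : ℕ) (a b : Fin d) (ω : ℕ → Site d) : ℕ → Site d :=
  spareExtension n b (cycRot n ω (npCutIdx n a b ω))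

/-- Images of `npClass` are spare free-ended `(n+1)`-step walks for the selector `prefSel n a`.
[cite: BDGS2012, §1.3] -/
theorem npMap_spare {n : ℕ} {a b : Fin d} (hab : a ≠ b) {ω : ℕ → Site d} (hω : ω ∈ npClass d n) :
    npMap n a b ω ∈ saws d (n + 1) ∧ EndFree (npMap n a b ω) (n + 1) ∧
      npMap n a b ω (n + 1) ≠ prefSel n a (npMap n a b ω) := by
  obtain ⟨hR, -, hclose, -⟩ := mem_npClass.1 hω
  obtain ⟨hs, -, -⟩ := mem_escapeResidual.1 hR
  obtain ⟨hj, hmax, -⟩ := npCutIdx_spec n a b ω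
  exact nearPolygon_spare hs hclose hj hab hmax (ne_cut_add_single hab ω)

/-- The rotation at `j < n` carries the closing edge `{ω n, ω 0}` to the consecutive times `n - 1 - j`,
`n - j`. [cite: MadrasSlade1993, §1.1] -/
theorem cycIdx_closing {n j : ℕ} (hj : j < n) : cycIdx n j (n - 1 - j) = n ∧ cycIdx n j (n - j) = 0 := by
  unfold cycIdx; constructor <;> split_ifs <;> omega

/-- **The rule is injective on `npClass`**: the rotated walk determines the cycle with its orientation;
the unique doubly-caged edge sits at the times `n - 1 - j, n - j` (or at the wrap-around when `j = n`), which
determines the cut index; rotating back recovers `ω`. [cite: BDGS2012, §1.3] -/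
theorem npMap_injOn (n : ℕ) (a b : Fin d) : Set.InjOn (npMap n a b) ↑(npClass d n) := by
  intro ω₁ h₁ ω₂ h₂ heq
  rw [Finset.mem_coe] at h₁ h₂
  obtain ⟨hR₁, ht₁, hcl₁, huniq₁⟩ := mem_npClass.1 h₁
  obtain ⟨hR₂, ht₂, hcl₂, huniq₂⟩ := mem_npClass.1 h₂
  obtain ⟨hs₁, -, hb₁⟩ := mem_escapeResidual.1 hR₁
  obtain ⟨hs₂, -, hb₂⟩ := mem_escapeResidual.1 hR₂
  set j₁ := npCutIdx n a b ω₁ with hj₁def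
  set j₂ := npCutIdx n a b ω₂ with hj₂def
  have hj₁ : j₁ ≤ n := (npCutIdx_spec n a b ω₁).1
  have hj₂ : j₂ ≤ n := (npCutIdx_spec n a b ω₂).1
  have hη₁ := cycRot_mem_saws hs₁ hcl₁ hj₁
  have hη₂ := cycRot_mem_saws hs₂ hcl₂ hj₂
  -- the rotated walks agree
  have hη : cycRot n ω₁ j₁ = cycRot n ω₂ j₂ := by
    have e : extendTo (cycRot n ω₁ j₁) n (cycRot n ω₁ j₁ n + Pi.single b 1) =
        extendTo (cycRot n ω₂ j₂) n (cycRot n ω₂ j₂ n + Pi.single b 1) := heq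
    rw [← restrictTo_extendTo hη₁ (cycRot n ω₁ j₁ n + Pi.single b 1),
      ← restrictTo_extendTo hη₂ (cycRot n ω₂ j₂ n + Pi.single b 1), e]
  set η := cycRot n ω₁ j₁ with hηdef
  -- caged sites of `η` by index, read through either rotation
  have hcaged₁ : ∀ t ≤ n, Caged η n (η t) ↔ Caged ω₁ n (ω₁ (cycIdx n j₁ t)) :=
    fun t ht => caged_cycRot_apply_iff hj₁ ht
  have hcaged₂ : ∀ t ≤ n, Caged η n (η t) ↔ Caged ω₂ n (ω₂ (cycIdx n j₂ t)) := by
    intro t ht; rw [hη]; exact caged_cycRot_apply_iff hj₂ ht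
  have hcn₁ := caged_end_of_extCount_eq_zero ht₁
  have hc0₁ := caged_start_of_extCount_revWalk_eq_zero hs₁ hb₁
  have hcn₂ := caged_end_of_extCount_eq_zero ht₂
  have hc0₂ := caged_start_of_extCount_revWalk_eq_zero hs₂ hb₂
  -- a doubly-caged consecutive pair of `η` at times `t < n`, `t + 1`, read in `ω₁`, must be the closing edge
  have key₁ : ∀ t < n, Caged η n (η t) → Caged η n (η (t + 1)) → cycIdx n j₁ t = n := by
    intro t ht hct hct1
    rcases cycIdx_succ hj₁ ht with ⟨hlt, hs⟩ | ⟨heqn, -⟩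
    · exfalso
      refine huniq₁ (cycIdx n j₁ t) hlt ⟨(hcaged₁ t ht.le).1 hct, ?_⟩
      rw [← hs]; exact (hcaged₁ (t + 1) (by omega)).1 hct1
    · exact heqn
  have key₂ : ∀ t < n, Caged η n (η t) → Caged η n (η (t + 1)) → cycIdx n j₂ t = n := by
    intro t ht hct hct1
    rcases cycIdx_succ hj₂ ht with ⟨hlt, hs⟩ | ⟨heqn, -⟩
    · exfalso
      refine huniq₂ (cycIdx n j₂ t) hlt ⟨(hcaged₂ t ht.le).1 hct, ?_⟩
      rw [← hs]; exact (hcaged₂ (t + 1) (by omega)).1 hct1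
    · exact heqn
  -- locate the closing edge of each walk inside `η` and conclude `j₁ = j₂`
  have hj : j₁ = j₂ := by
    rcases Nat.lt_or_ge j₁ n with hlt₁ | hge₁ <;> rcases Nat.lt_or_ge j₂ n with hlt₂ | hge₂
    · -- both cut inside: the closing edge of `ω₂` sits at `n - 1 - j₂`, read in `ω₁` it must be the closing edge
      obtain ⟨hcA, hcB⟩ := cycIdx_closing hlt₂
      have hct : Caged η n (η (n - 1 - j₂)) := (hcaged₂ _ (by omega)).2 (by rw [hcA]; exact hcn₂)
      have hct1 : Caged η n (η (n - 1 - j₂ + 1)) := (hcaged₂ _ (by omega)).2 (by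
        rw [show n - 1 - j₂ + 1 = n - j₂ by omega, hcB]; exact hc0₂)
      have h1 := key₁ (n - 1 - j₂) (by omega) hct hct1
      have h2 := (cycIdx_closing hlt₁).1
      unfold cycIdx at h1 h2; split_ifs at h1 h2 <;> omega
    · -- `j₂ = n`: `η = ω₂`; the closing edge of `ω₁` at `n - 1 - j₁ < n` would be a second caged pair of `ω₂`
      exfalso
      have hj₂n : j₂ = n := le_antisymm hj₂ hge₂
      obtain ⟨hcA, hcB⟩ := cycIdx_closing hlt₁
      have hct : Caged η n (η (n - 1 - j₁)) := (hcaged₁ _ (by omega)).2 (by rw [hcA]; exact hcn₁)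
      have hct1 : Caged η n (η (n - 1 - j₁ + 1)) := (hcaged₁ _ (by omega)).2 (by
        rw [show n - 1 - j₁ + 1 = n - j₁ by omega, hcB]; exact hc0₁)
      have h1 := key₂ (n - 1 - j₁) (by omega) hct hct1
      rw [hj₂n] at h1
      unfold cycIdx at h1; split_ifs at h1 <;> omega
    · exfalso
      have hj₁n : j₁ = n := le_antisymm hj₁ hge₁
      obtain ⟨hcA, hcB⟩ := cycIdx_closing hlt₂
      have hct : Caged η n (η (n - 1 - j₂)) := (hcaged₂ _ (by omega)).2 (by rw [hcA]; exact hcn₂)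
      have hct1 : Caged η n (η (n - 1 - j₂ + 1)) := (hcaged₂ _ (by omega)).2 (by
        rw [show n - 1 - j₂ + 1 = n - j₂ by omega, hcB]; exact hc0₂)
      have h1 := key₁ (n - 1 - j₂) (by omega) hct hct1
      rw [hj₁n] at h1
      unfold cycIdx at h1; split_ifs at h1 <;> omega
    · omega
  -- rotate back
  rcases Nat.lt_or_ge j₁ n with hlt | hge
  · rw [← cycRot_cycRot hs₁ hlt, ← hηdef, hη, ← hj, cycRot_cycRot hs₂ hlt]
  · have hj₁n : j₁ = n := le_antisymm hj₁ hge
    have e1 : cycRot n ω₁ j₁ = ω₁ := by rw [hj₁n]; exact cycRot_last hs₁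
    have e2 : cycRot n ω₂ j₂ = ω₂ := by rw [← hj, hj₁n]; exact cycRot_last hs₂
    rw [← e1, ← hηdef, hη, e2]

/-! ### `cₙ ≤ cₙ₊₁ + #(R \ S)` -/

open Classical in
/-- **The near-polygon rule sharpens the escape reduction: `cₙ ≤ cₙ₊₁ + #(R(d,n) \ npClass d n)`** for any
two distinct coordinates `a ≠ b` (so `d ≥ 2`).  At `n = 6d - 1`, `d = 2, 3`, the lane's exhaustive census
finds `R \ npClass = ∅` (not used here). [cite: BDGS2012, §1.3] -/
theorem count_le_count_succ_add_card_sdiff_npClass {n : ℕ} {a b : Fin d} (hab : a ≠ b) :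
    count d n ≤ count d (n + 1) + (escapeResidual d n \ npClass d n).card :=
  count_le_count_succ_add_card_sdiff_of_spare (prefSel_isEscapeSelector n a) (npClass d n) (npMap n a b)
    (fun _ hω => npMap_spare hab hω) (npMap_injOn n a b)

open Classical in
/-- In particular O'Brien's inequality holds at every length where all residual walks are near-polygons with
a unique doubly-caged cycle edge. [cite: BDGS2012, §1.3] -/
theorem count_le_count_succ_of_npClass_eq {n : ℕ} {a b : Fin d} (hab : a ≠ b)
    (h : npClass d n = escapeResidual d n) : count d n ≤ count d (n + 1) := by
  have := count_le_count_succ_add_card_sdiff_npClass (n := n) hab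
  rw [h, Finset.sdiff_self, Finset.card_empty, add_zero] at this
  exact this

end Literature.Probability.RandomPlanarGeometry.SAW.Zd
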